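import Summits.Langlands.Langlands.Theorems.ExteriorSquareAscentSelfTwistedIrreducibleDefs
import Literature.NumberTheory.Automorphic.ArthurClozelBaseChange
import Literature.NumberTheory.Automorphic.ArthurClozelGalOrbitLift
import Literature.NumberTheory.Automorphic.RamakrishnanMultiplicityOneDihedral
import Literature.NumberTheory.Automorphic.AutomorphicInductionCuspidalProofs
import Literature.NumberTheory.Automorphic.HenniartAutomorphicInductionStagesCuspidal
import Literature.NumberTheory.Automorphic.QuadraticCharacterTwist
import Literature.NumberTheory.Automorphic.AutomorphicTwistNorm
import HarnessLib

/-!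
# Crux `SelfTwistedIrreducible` (stmt-Langlands-18055), line `Sketch`:
# stub `stub_automorphicInduction`

A cuspidal `π` on `GL₄(𝔸_K)` whose Satake parameters are self-twisted, at almost every place, by
the quadratic sign `ε_{L/K}` of a quadratic extension `L/K` is automorphically induced from a
cuspidal `f` on `GL₂(𝔸_L)` (Arthur–Clozel, Ch. 3, Def. 6.1: `IsAutomorphicInductionAlong f.1 π.1`)
whose Satake data are not `Gal(L/K)`-stable, GRANTED, as hypotheses, the unproved named facts of
the tree: Arthur–Clozel Ch. 3 Thm. 4.2 (b) in the `L²` model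
(`ArthurClozel1989_inducedLift_of_twist_eq`), multiplicity one (`multiplicity_one_gl`) and
Jacquet–Shalika (2.2)/(2.3) (`JacquetShalika1981_partialPairL_at_one_of_ne_conj`,
`JacquetShalika1981_partialPairL_pole_of_eq_conj`).

Proof (the rank-`2 → 1` pattern of `RamakrishnanMultiplicityOneDihedral`, here `4 → 2`, composed
with the assembly of `AutomorphicInductionCuspidalProofs`):
* the class-field character `η` of `L/K` (`exists_isClassFieldCharacter_holds`) takes the value
  `ε_{L/K}(v)` at almost every `v` (`eventually_isPrimitiveRoot_valueAtUniformizer`,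
  `valueAtUniformizer_eq_quadraticSign_of_orderOf`), so the self-twist reads
  `η(ϖ_v) t_{π,v} = t_{π,v}` a.e.;
* the unitary `L²` avatar `P` of `π` (`exists_satake_eq_cpow_mul_L2_unconditional`:
  `t_{π,v} = q_v^{s} α_P(v)`) then satisfies `P ⊗ η = P` by strong multiplicity one
  (`twistByFiniteOrderChar_eq_self_of_satake_fixed`, any rank);
* Thm. 4.2 (b) gives a cuspidal `Q₁` on `GL₂/L`, not Galois-stable, whose Galois orbit lifts `P`
  (`IsWeakBaseChangeLiftOfGalOrbit.eventually_sum_eq_map_pow`: `∑_σ A(σ⁻¹ w) = α_P(v)^{f(w|v)}`);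
* `Q₁` is realised by a Borel–Jacquet datum (`exists_cuspidalRepData_eventually_hasSatakeParamAt`),
  twisted by `|det|^{s}` into `f` with `t_{f,w} = q_w^{s} A(w)` a.e.;
* (6.5)–(6.6) ⟹ (6.1)–(6.2) (`satakePolynomial_eq_inducedSatakePolynomial_of_sum_smul_eq`) gives
  `IsAutomorphicInductionAlong f.1 π.1`, and the orbit of the inducing datum of a cuspidal
  automorphic induction is regular
  (`IsAutomorphicInductionAlong.not_isGaloisStableSatakeAE_of_cuspidal`).

References: J. Arthur, L. Clozel, *Simple algebras, base change, and the advanced theory of the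
trace formula*, Ann. of Math. Stud. 120 (1989), Ch. 3, Thm. 4.2 (b), §6 [ArthurClozelAMS120].
-/

set_option linter.dupNamespace false -- `Summit.Langlands.Langlands` is the mandated namespace

noncomputable section

namespace Summit.Langlands.Langlands.Cruxes.SelfTwistedIrreducible.DetPinning

open scoped NumberField Polynomial Classical
open Filter Polynomial NumberField IsDedekindDomain Field
open Literature.NumberTheory.GaloisRepresentations Literature.NumberTheory.Automorphic
open MeasureTheory AdelicGroupData

/-! ## Auxiliary: a Satake-level self-twist is a self-twist in `L²_cusp` (any rank) -/

/-- **A Satake-level twist-invariance is `P ⊗ δ = P` in `L²_cusp`** (strong multiplicity one, any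
rank `n ≥ 1`). If the cuspidal `P ≤ L²_cusp(GL_n(𝔸_F))` has a Satake family `α_P` off the finite `S`
with `δ(ϖ_v) α_P(v) = α_P(v)` at almost every `v`, for a Hecke character `δ` of finite order, then
`P ⊗ δ = P`: the twist has the Satake family `δ(ϖ_v) α_P(v)` (`IsSatakeFamilyOf.twistByChar`),
equal to `α_P` off a finite set, and strong multiplicity one in Satake-family form
(`eq_of_isSatakeFamilyOf_of_jacquetShalika`, from multiplicity one and Jacquet–Shalika (2.2)–(2.3))
applies. The rank-`2` case is `twistByFiniteOrderChar_eq_self_of_isSatakeTwistBy`.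
[cite: Ramakrishnan2000, §4.1, proof of Thm. 4.1.2 (p. 38)] -/
theorem twistByFiniteOrderChar_eq_self_of_satake_fixed {n : ℕ} {F : Type} [Field F] [NumberField F]
    (hn : 0 < n) {μ₀ : Measure (gl n F).automorphicQuotient} [(gl n F).IsAutomorphicMeasure μ₀]
    (hm1 : multiplicity_one_gl n F μ₀)
    (h22 : JacquetShalika1981_partialPairL_at_one_of_ne_conj (n := n) (K := F) (μ := μ₀))
    (h23 : JacquetShalika1981_partialPairL_pole_of_eq_conj (n := n) (K := F) (μ := μ₀))
    {δ : HeckeCharacter F} (hfo : δ.IsFiniteOrder) {P : CuspidalAutomorphicRepGL n F μ₀}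
    {S : Set (HeightOneSpectrum (𝓞 F))} (hS : S.Finite) {αP : SatakeFamily F}
    (hαP : IsSatakeFamilyOf P S αP)
    (hfix : ∀ᶠ v : HeightOneSpectrum (𝓞 F) in cofinite,
      (αP v).map (δ.valueAtUniformizer v * ·) = αP v) :
    P.twistByFiniteOrderChar δ hfo = P := by
  classical
  -- adapted from `twistByFiniteOrderChar_eq_self_of_isSatakeTwistBy` (rank 2)
  obtain ⟨𝔪, h𝔪, hδ𝔪⟩ := HeckeCharacter.exists_level_of_isFiniteOrder n hfo
  set S' : Set (HeightOneSpectrum (𝓞 F)) :=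
    S ∪ {v | v.asIdeal ∣ 𝔪} ∪ {v | ¬ (αP v).map (δ.valueAtUniformizer v * ·) = αP v} with hS'def
  have hS'fin : S'.Finite :=
    (hS.union (Ideal.finite_factors h𝔪)).union (Filter.eventually_cofinite.mp hfix)
  have hαS' : IsSatakeFamilyOf P S' αP :=
    hαP.mono fun v hv => Set.mem_union_left _ (Set.mem_union_left _ hv)
  have hS'𝔪 : ∀ v ∉ S', ¬ v.asIdeal ∣ 𝔪 := fun v hv hd =>
    hv (Set.mem_union_left _ (Set.mem_union_right _ hd))
  have hS'fix : ∀ v ∉ S', (αP v).map (δ.valueAtUniformizer v * ·) = αP v := by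
    intro v hv
    by_contra hc
    exact hv (Set.mem_union_right _ hc)
  have hδ₀ : ∀ t, δ (posRealIdele F t) = 1 := fun t =>
    HeckeCharacter.map_posRealIdele_of_isFiniteOrder hfo t
  have htw : IsSatakeFamilyOf (P.twistByFiniteOrderChar δ hfo) S'
      fun v => (αP v).map (δ.valueAtUniformizer v * ·) :=
    hαS'.twistByChar δ hfo.isUnitary hδ₀ h𝔪 hδ𝔪 hS'𝔪
  have htw' : IsSatakeFamilyOf (P.twistByFiniteOrderChar δ hfo) S' αP := htw.congr hS'fix
  exact CuspidalAutomorphicRepGL.eq_of_isSatakeFamilyOf_of_jacquetShalika hn hm1 h22 h23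
    hS'fin htw' hαS'

/-! ## Auxiliary: from the lifted Galois orbit to automorphic induction of Borel–Jacquet data -/

/-- **From Thm. 4.2 (b)'s lifted orbit to Def. 6.1** (Arthur–Clozel, Ch. 3, proof of Thm. 6.2,
(6.5)–(6.6) ⟹ (6.1)–(6.2), run for data). Let `L/K` be Galois of prime degree with class-field
character `η`; `π` a cuspidal datum on `GL_N/K` with unitary avatar `P` (`t_{π,v} = q_v^{s} α_P(v)`
exactly off the finite `S`) such that `η(ϖ_v) α_P(v) = α_P(v)` a.e.; `Q₁` cuspidal on `GL_m/L` in
`L²` with Satake family `A` off `S₁`, whose Galois orbit lifts `P`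
(`IsWeakBaseChangeLiftOfGalOrbit`); and `f` a datum on `GL_m/L` with `t_{f,w} = q_w^{s} A(w)` a.e.
Then `π` is automorphically induced from `f`: at almost every `v`, with `w₀ ∣ v`,
`∑_σ t_{f,σ⁻¹ w₀} = t_{π,v}^{f(w₀|v)}` (`eventually_sum_eq_map_pow`, `q_w = q_v^{f}`) and
`t_{π,v}` is stable under the primitive `f(w₀|v)`-th root of unity `η(ϖ_v)`
(`eventually_isPrimitiveRoot_valueAtUniformizer`), whence (6.1)–(6.2)
(`satakePolynomial_eq_inducedSatakePolynomial_of_sum_smul_eq`).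
[cite: ArthurClozelAMS120, Ch. 3, proof of Thm. 6.2 ((6.5)–(6.6) ⟹ (6.1)–(6.2), PDF p. 185)] -/
theorem isAutomorphicInductionAlong_of_galOrbitLift {K L : Type} [Field K] [NumberField K]
    [Field L] [NumberField L] [Algebra K L] [IsGalois K L] (hl : (Module.finrank K L).Prime)
    {η : HeckeCharacter K} (hη : η.IsClassFieldCharacter L)
    {N m : ℕ} {hK : isCompact_glFiniteIntegralLevel N K} {hL : isCompact_glFiniteIntegralLevel m L}
    (π : CuspidalAutomorphicRepData N K hK) (f : CuspidalAutomorphicRepData m L hL)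
    {μ : Measure (gl N K).automorphicQuotient} [(gl N K).IsAutomorphicMeasure μ]
    {ν : Measure (gl m L).automorphicQuotient} [(gl m L).IsAutomorphicMeasure ν]
    {P : CuspidalAutomorphicRepGL N K μ} {s : ℂ} {S : Set (HeightOneSpectrum (𝓞 K))}
    (hS : S.Finite) {αP : SatakeFamily K} (hαP : IsSatakeFamilyOf P S αP)
    (hiff : ∀ v ∉ S, ∀ β : Multiset ℂ,
      π.1.HasSatakeParamAt v β ↔ β = (αP v).map (((v.residueCard : ℂ) ^ s) * ·))
    (hfix : ∀ᶠ v : HeightOneSpectrum (𝓞 K) in cofinite,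
      (αP v).map (η.valueAtUniformizer v * ·) = αP v)
    {hν : IsGalInvariant K ν} {Q₁ : CuspidalAutomorphicRepGL m L ν}
    (hlift : IsWeakBaseChangeLiftOfGalOrbit P.1 Q₁ hν)
    {S₁ : Set (HeightOneSpectrum (𝓞 L))} (hS₁ : S₁.Finite) {A : SatakeFamily L}
    (hA : IsSatakeFamilyOf Q₁ S₁ A)
    (hf : ∀ᶠ w : HeightOneSpectrum (𝓞 L) in cofinite,
      f.1.HasSatakeParamAt w ((A w).map (((w.residueCard : ℂ) ^ s) * ·))) :
    IsAutomorphicInductionAlong f.1 π.1 := by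
  classical
  -- adapted from `automorphicInduction_cyclic_cuspidal_of_normalisation_of_realisation`, Steps E–F
  haveI : FiniteDimensional K L := Module.finite_of_finrank_pos hl.pos
  have hrel := hlift.eventually_sum_eq_map_pow hαP fun σ => hA.galConj K hν σ
  have hgoodL : ∀ᶠ w : HeightOneSpectrum (𝓞 L) in cofinite,
      (∀ β : Multiset ℂ, f.1.HasSatakeParamAt w β →
        β = (A w).map (((w.residueCard : ℂ) ^ s) * ·)) ∧
      (w.under (𝓞 K) ∉ S → ∑ σ : L ≃ₐ[K] L, A (σ⁻¹ • w) =
        (αP (w.under (𝓞 K))).map (· ^ w.asIdeal.inertiaDeg (𝓞 K))) := by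
    have hS0 : ∀ᶠ w : HeightOneSpectrum (𝓞 L) in cofinite, w ∉ S₁ := hS₁.eventually_cofinite_notMem
    have hSσ : ∀ᶠ w : HeightOneSpectrum (𝓞 L) in cofinite, ∀ σ : L ≃ₐ[K] L, σ⁻¹ • w ∉ S₁ :=
      eventually_all.2 fun σ => (tendsto_inv_smul_cofinite (𝓞 L) σ).eventually hS0
    filter_upwards [hf, hSσ, hrel] with w hw hσ hr
    exact ⟨fun β hβ => f.1.hasSatakeParamAt_unique_holds hβ hw, fun hwS => hr hwS fun σ => hσ σ⟩
  have c1 : ∀ᶠ v : HeightOneSpectrum (𝓞 K) in cofinite, v ∉ S := hS.eventually_cofinite_notMem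
  have c2 := eventually_forall_under_eq (F := K) hgoodL
  have c3 : ∀ᶠ v : HeightOneSpectrum (𝓞 K) in cofinite, Algebra.IsUnramifiedIn (𝓞 L) v.asIdeal :=
    eventually_cofinite.2 (finite_setOf_not_isUnramifiedIn K L)
  have c4 := hη.eventually_isPrimitiveRoot_valueAtUniformizer hl
  filter_upwards [c1, c2, c3, c4, hfix] with v hv1 hv2 hv3 hv4 hv5 β hβ
  -- the Satake parameter `q_v^{s} α_P(v)` of `π` at `v`
  have hπv : π.1.HasSatakeParamAt v ((αP v).map (((v.residueCard : ℂ) ^ s) * ·)) :=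
    (hiff v hv1 _).2 rfl
  refine ⟨_, hπv, ?_⟩
  -- a place `w₀ ∣ v`; the relation (6.5)–(6.6) at `w₀`
  obtain ⟨w₀, hw₀⟩ : ∃ w₀ : HeightOneSpectrum (𝓞 L), w₀.under (𝓞 K) = v :=
    HeightOneSpectrum.under_surjective v
  have hw₀' : w₀.asIdeal.under (𝓞 K) = v.asIdeal := congrArg HeightOneSpectrum.asIdeal hw₀
  have hw₀S : w₀.under (𝓞 K) ∉ S := by rw [hw₀]; exact hv1
  obtain ⟨-, hR0⟩ := hv2 w₀ hw₀'
  have hR' := hR0 hw₀S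
  rw [hw₀] at hR'
  -- `β w = q_w^{s} A(w)` for `w ∣ v` (uniqueness of Satake parameters of `f`)
  have hβ' : ∀ w : HeightOneSpectrum (𝓞 L), w.asIdeal.under (𝓞 K) = v.asIdeal →
      β w = (A w).map (((w.residueCard : ℂ) ^ s) * ·) := fun w hw =>
    (hv2 w hw).1 _ (hβ w hw)
  -- `q_{w₀}^{s} = (q_v^{s})^{f}`
  have hq : (w₀.residueCard : ℂ) ^ s =
      ((v.residueCard : ℂ) ^ s) ^ w₀.asIdeal.inertiaDeg (𝓞 K) := by
    rw [residueCard_eq_pow_inertiaDeg (F := K) w₀, hw₀, natCast_pow_cpow]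
  -- (6.5)–(6.6) for the twisted families: `∑_σ β(σ⁻¹ w₀) = (q_v^{s} α_P(v))^{f}`
  have hRβ : ∑ σ : L ≃ₐ[K] L, β (σ⁻¹ • w₀) =
      ((αP v).map (((v.residueCard : ℂ) ^ s) * ·)).map (· ^ w₀.asIdeal.inertiaDeg (𝓞 K)) := by
    have h1 : ∀ σ : L ≃ₐ[K] L,
        β (σ⁻¹ • w₀) = (A (σ⁻¹ • w₀)).map (((w₀.residueCard : ℂ) ^ s) * ·) := by
      intro σ
      rw [hβ' (σ⁻¹ • w₀) ?_, residueCard_smul K σ⁻¹ w₀]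
      rw [← hw₀']
      exact congrArg HeightOneSpectrum.asIdeal (HeightOneSpectrum.under_algEquiv_smul K L σ⁻¹ w₀)
    calc ∑ σ : L ≃ₐ[K] L, β (σ⁻¹ • w₀)
          = ∑ σ : L ≃ₐ[K] L, (A (σ⁻¹ • w₀)).map (((w₀.residueCard : ℂ) ^ s) * ·) :=
        Finset.sum_congr rfl fun σ _ => h1 σ
      _ = (∑ σ : L ≃ₐ[K] L, A (σ⁻¹ • w₀)).map (((w₀.residueCard : ℂ) ^ s) * ·) :=
        (multiset_map_finset_sum _ _ _).symm
      _ = ((αP v).map (((v.residueCard : ℂ) ^ s) * ·)).map (· ^ w₀.asIdeal.inertiaDeg (𝓞 K)) := by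
        rw [hR', Multiset.map_map, Multiset.map_map]
        refine Multiset.map_congr rfl fun b _ => ?_
        simp only [Function.comp_apply]
        rw [mul_pow, ← hq]
  -- `ζ = η(ϖ_v)`-stability of `q_v^{s} α_P(v)`, `ζ` a primitive `f`-th root of unity
  have hZ : ((αP v).map (((v.residueCard : ℂ) ^ s) * ·)).map (η.valueAtUniformizer v * ·) =
      (αP v).map (((v.residueCard : ℂ) ^ s) * ·) := by
    conv_rhs => rw [← hv5]
    rw [Multiset.map_map, Multiset.map_map]
    refine Multiset.map_congr rfl fun b _ => ?_
    simp only [Function.comp_apply]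
    ring
  have hζ : IsPrimitiveRoot (η.valueAtUniformizer v) (w₀.asIdeal.inertiaDeg (𝓞 K)) := by
    rw [inertiaDeg_eq_inertiaDegIn_of_under_eq v hw₀']
    exact hv4
  exact satakePolynomial_eq_inducedSatakePolynomial_of_sum_smul_eq hl hv3 hw₀' β hRβ hζ hZ

/-! ## The stub -/

/-- **Stub 1 of line `Sketch` (automorphic induction).** Granted Arthur–Clozel Ch. 3 Thm. 4.2 (b)
(`L²` model), multiplicity one and Jacquet–Shalika (2.2)/(2.3) (`L²` model) as hypotheses: a
cuspidal `π` on `GL₄(𝔸_K)` self-twisted a.e. by the quadratic sign of the quadratic `L/K`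
(`IsQuadSelfTwisted π L`) is automorphically induced (Arthur–Clozel, Ch. 3, Def. 6.1) from a
cuspidal `f` on `GL₂(𝔸_L)` whose Satake data are not `Gal(L/K)`-stable.
[cite: ArthurClozelAMS120, Ch. 3, Thm. 4.2 (b) and §6 (Def. 6.1, Thm. 6.2, Lemma 6.4)] -/
theorem stub_automorphicInduction :
    (∀ (n : ℕ) (F E : Type) [Field F] [NumberField F] [Field E] [NumberField E] [Algebra F E],
        ArthurClozel1989_inducedLift_of_twist_eq n F E) →
    (∀ (n : ℕ) (F : Type) [Field F] [NumberField F]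
        (μ : MeasureTheory.Measure (AdelicGroupData.gl n F).automorphicQuotient)
        [(AdelicGroupData.gl n F).IsAutomorphicMeasure μ], multiplicity_one_gl n F μ) →
    (∀ (n : ℕ) (F : Type) [Field F] [NumberField F]
        (μ : MeasureTheory.Measure (AdelicGroupData.gl n F).automorphicQuotient)
        [(AdelicGroupData.gl n F).IsAutomorphicMeasure μ],
        JacquetShalika1981_partialPairL_at_one_of_ne_conj (n := n) (K := F) (μ := μ)) →
    (∀ (n : ℕ) (F : Type) [Field F] [NumberField F]
        (μ : MeasureTheory.Measure (AdelicGroupData.gl n F).automorphicQuotient)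
        [(AdelicGroupData.gl n F).IsAutomorphicMeasure μ],
        JacquetShalika1981_partialPairL_pole_of_eq_conj (n := n) (K := F) (μ := μ)) →
    ∀ (K : Type) [Field K] [NumberField K] (hcpt : isCompact_glFiniteIntegralLevel 4 K)
      (π : CuspidalAutomorphicRepData 4 K hcpt) (L : Type) [Field L] [NumberField L] [Algebra K L],
      IsQuadSelfTwisted π L → ∀ hL2 : isCompact_glFiniteIntegralLevel 2 L,
        ∃ f : CuspidalAutomorphicRepData 2 L hL2,
          IsAutomorphicInductionAlong f.1 π.1 ∧ ¬ IsGaloisStableSatakeAE K f.1 := by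
  intro hAC hm1 h22 h23 K _ _ hcpt π L _ _ _ hq hL2
  classical
  obtain ⟨h2, hst⟩ := hq
  -- (0) `L/K` is Galois, cyclic, of prime degree `2`
  haveI : Algebra.IsQuadraticExtension K L := ⟨h2⟩
  haveI : IsGalois K L := inferInstance
  have hprime : (Module.finrank K L).Prime := by rw [h2]; exact Nat.prime_two
  have h4 : (0 : ℕ) < 4 := by norm_num
  haveI : NeZero (4 : ℕ) := ⟨four_ne_zero⟩
  haveI : NeZero (2 : ℕ) := ⟨two_ne_zero⟩
  -- the automorphic measure on `GL₄(𝔸_K) ⧸ A_G GL₄(K)` and the class-field character `η` of `L/K`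
  obtain ⟨μ, hμ⟩ := AdelicGroupData.exists_isAutomorphicMeasure_gl_holds 4 K
  haveI := hμ
  obtain ⟨η, hηcf, -⟩ : ∃ η : HeckeCharacter K,
      η.IsClassFieldCharacter L ∧ orderOf η = Module.finrank K L :=
    exists_isClassFieldCharacter_holds (F := K) (E := L)
  -- `η(ϖ_v) = ε_{L/K}(v)` almost everywhere
  have hunr : ∀ᶠ v : HeightOneSpectrum (𝓞 K) in cofinite, Algebra.IsUnramifiedIn (𝓞 L) v.asIdeal :=
    eventually_cofinite.2 (finite_setOf_not_isUnramifiedIn K L)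
  have hηq : ∀ᶠ v : HeightOneSpectrum (𝓞 K) in cofinite,
      η.valueAtUniformizer v = quadraticSign L v := by
    filter_upwards [hηcf.eventually_isPrimitiveRoot_valueAtUniformizer hprime, hunr] with v hv hvu
    exact valueAtUniformizer_eq_quadraticSign_of_orderOf h2 η hvu hv.eq_orderOf.symm
  -- the self-twist through `η`: `η(ϖ_v) t_{π,v} = t_{π,v}` a.e.
  have hst' : ∀ᶠ v : HeightOneSpectrum (𝓞 K) in cofinite, ∀ α : Multiset ℂ,
      π.1.HasSatakeParamAt v α → α.map (η.valueAtUniformizer v * ·) = α := by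
    filter_upwards [hst, hηq] with v hv hvq α hα
    rw [hvq]
    exact hv α hα
  -- (1) the unitary `L²` avatar `P` of `π`: `t_{π,v} = q_v^{s} α_P(v)` off `S`
  obtain ⟨s, P, S, αP, hS, hαP, hiff⟩ :=
    CuspidalAutomorphicRepData.exists_satake_eq_cpow_mul_L2_unconditional hcpt μ π
  -- (2) `η(ϖ_v) α_P(v) = α_P(v)` a.e., hence `P ⊗ η = P`
  have hfix : ∀ᶠ v : HeightOneSpectrum (𝓞 K) in cofinite,
      (αP v).map (η.valueAtUniformizer v * ·) = αP v := by
    filter_upwards [hst', hS.eventually_cofinite_notMem] with v hv hvS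
    have h1 : π.1.HasSatakeParamAt v ((αP v).map (((v.residueCard : ℂ) ^ s) * ·)) :=
      (hiff v hvS _).2 rfl
    have h3 := hv _ h1
    refine multiset_map_mul_eq_self_of_map_mul_eq (c := (v.residueCard : ℂ) ^ s) ?_ h3
    intro h
    have h0 := (Complex.cpow_eq_zero_iff _ _).1 h
    have hq0 : (v.residueCard : ℂ) ≠ 0 := by
      have := v.one_lt_residueCard
      exact_mod_cast (by omega : v.residueCard ≠ 0)
    exact hq0 h0.1
  have hPP : P.twistByFiniteOrderChar η hηcf.isFiniteOrder = P :=
    twistByFiniteOrderChar_eq_self_of_satake_fixed h4 (hm1 4 K μ) (h22 4 K μ) (h23 4 K μ)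
      hηcf.isFiniteOrder hS hαP hfix
  -- (3) Arthur–Clozel, Thm. 4.2 (b): the cuspidal `Q₁` on `GL(4/2)/L` whose Galois orbit lifts `P`
  obtain ⟨-, ν, hνA, hν, Q₁, hnst, hlift⟩ := hAC 4 K L h4 hprime η hηcf μ P hPP
  haveI := hνA
  -- transport the rank `4 / [L:K]` to `2`
  suffices key : ∀ (m : ℕ) (ν : Measure (gl m L).automorphicQuotient)
      [(gl m L).IsAutomorphicMeasure ν] (hν : IsGalInvariant K ν)
      (Q₁ : CuspidalAutomorphicRepGL m L ν), IsWeakBaseChangeLiftOfGalOrbit P.1 Q₁ hν → m = 2 →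
      ∃ f : CuspidalAutomorphicRepData 2 L hL2,
        IsAutomorphicInductionAlong f.1 π.1 ∧ ¬ IsGaloisStableSatakeAE K f.1 by
    exact key _ ν hν Q₁ hlift (by rw [h2])
  intro m ν _ hν Q₁ hlift hm
  subst hm
  -- (4) the Satake family `A` of `Q₁`, a datum `f₀` realising it, and the norm twist
  -- `f = f₀ ⊗ |det|^{s}`
  obtain ⟨S₁, A, -, hA⟩ := exists_isSatakeFamilyOf_holds (n := 2) (K := L) (μ := ν) Q₁
  obtain ⟨f₀, hf₀⟩ :=
    CuspidalAutomorphicRepGL.exists_cuspidalRepData_eventually_hasSatakeParamAt hL2 Q₁ hA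
      S₁.finite_toSet
  obtain ⟨χ, hχ⟩ := exists_heckeCharacter_ideleNorm_cpow L (-s)
  obtain ⟨f, hfW, hfW'⟩ := exists_cuspidalAutomorphicRepData_map_mulChar_detTwist hχ f₀
  have hfSat : ∀ᶠ w : HeightOneSpectrum (𝓞 L) in cofinite,
      f.1.HasSatakeParamAt w ((A w).map (((w.residueCard : ℂ) ^ s) * ·)) := by
    filter_upwards [hf₀] with w hw
    have h := AutomorphicRepData.HasSatakeParamAt.of_map_mulChar_detTwist_of_cpow hχ hfW hfW' hw
    rwa [neg_neg] at h
  -- (5) `π` is automorphically induced from `f`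
  have hAI : IsAutomorphicInductionAlong f.1 π.1 :=
    isAutomorphicInductionAlong_of_galOrbitLift hprime hηcf π f hS hαP hiff hfix hlift
      S₁.finite_toSet hA hfSat
  refine ⟨f, hAI, ?_⟩
  -- (6) the orbit of the inducing datum of a cuspidal automorphic induction is regular
  exact hAI.not_isGaloisStableSatakeAE_of_cuspidal (K := K) (K₁ := K) two_pos (h23 4 K) (h22 2 L)
    (h23 2 L) (hm1 2 L) (by rw [h2]; exact one_lt_two)

end Summit.Langlands.Langlands.Cruxes.SelfTwistedIrreducible.DetPinning

end
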